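import Mathlib
import Literature.Probability.PointProcesses.LensConsistentLaw
import Literature.Probability.Process.RootedHardCoreVague
import Summits.AtomisticToContinuum.Crystallization.Theorems.FrustrationRangeCertificatesPatternPricedCertificatesStubLevelLift
import Summits.AtomisticToContinuum.Crystallization.Theorems.FrustrationRangeCertificatesPatternPricedCertificatesStubMeanDuality
import HarnessLib

/-!
# Crux `PatternPricedCertificates` (stmt-AtomisticToContinuum-12974), line `registered`: helpers for `stub_meanCampbell`

Pattern-level plumbing for the Campbell / re-rooting identity of the law representing a point-stationary
mean family (file `…StubMeanCampbell.lean`). For the finite embedding `ι` (`↑(ι T) = insert 0 T` on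
admissible rooted patterns `T`) and a continuous local test function `G(S, y)` vanishing for `‖y‖ > R`:

* re-rooting commutes with the embedding (`(ι T) − v = ι (reroot T v)`, `meanCampbell_iota_reroot`), and the
  two Campbell integrands evaluated on `ι T` are finite sums, with difference
  `Σ_{v ∈ T, ‖v‖ ≤ R} [G(ι T, v) − G(ι(reroot T v), −v)]` (`meanCampbell_diff_eq`);
* the level-`(r, ρ)` transport of the bounded rule `g v p q = 1[‖v‖ ≤ R] G(ι p, v)` is the same sum with
  every pattern cut to its `r`-ball (`meanCampbell_transport_eq`, `R ≤ ρ − r`);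
* cutting to the `r`-ball moves `ι T` by at most `r⁻¹` in the local rubber metric
  (`meanCampbell_dist_iota_ballPattern`), so by uniform continuity of `G` on the compact
  `𝒳 × B̄_R` and the packing bound, the difference of the two is uniformly small on admissible patterns:
  the LEVEL ESTIMATE `meanCampbell_levelEstimate` (registered sub-goal of `stub_meanCampbell`).
All `[folklore]`.
-/

noncomputable section

open scoped BigOperators Classical
open MeasureTheory

namespace Summit.AtomisticToContinuum.Crystallization.Theorems.PatternPricedCertificates

open Literature.Probability.PointProcesses (IsRootedPattern ballPattern lens reroot)
open Literature.Probability.Process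

section PatternLemmas

/-- An admissible pattern (positive separation) does not list the root. [folklore] -/
theorem meanCampbell_zero_notMem {δ ρ : ℝ} (hδ : 0 < δ) {T : Finset (EuclideanSpace ℝ (Fin 3))}
    (hT : IsRootedPattern δ ρ T) : (0 : EuclideanSpace ℝ (Fin 3)) ∉ T := fun h => by
  have h1 := (hT.1 0 h).1
  rw [norm_zero] at h1
  exact absurd h1 (not_le.2 hδ)

/-- Re-rooting and re-inserting the root is translating the rooted point set:
`insert 0 (reroot T v) = (insert 0 T) − v` for `v ∈ T`. [folklore] -/
theorem meanCampbell_insert_reroot (T : Finset (EuclideanSpace ℝ (Fin 3))) {v : EuclideanSpace ℝ (Fin 3)}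
    (hv : v ∈ T) :
    insert (0 : EuclideanSpace ℝ (Fin 3)) (reroot T v) =
      (insert (0 : EuclideanSpace ℝ (Fin 3)) T).image (fun w => w - v) := by
  unfold reroot
  rw [Finset.insert_erase]
  exact Finset.mem_image.2 ⟨v, Finset.mem_insert_of_mem hv, sub_self v⟩

/-- Set version of `meanCampbell_insert_reroot`. [folklore] -/
theorem meanCampbell_coe_insert_reroot (T : Finset (EuclideanSpace ℝ (Fin 3))) {v : EuclideanSpace ℝ (Fin 3)}
    (hv : v ∈ T) :
    insert (0 : EuclideanSpace ℝ (Fin 3)) (↑(reroot T v) : Set (EuclideanSpace ℝ (Fin 3))) =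
      (fun w => w - v) '' insert (0 : EuclideanSpace ℝ (Fin 3)) (↑T : Set (EuclideanSpace ℝ (Fin 3))) := by
  rw [← Finset.coe_insert, meanCampbell_insert_reroot T hv, Finset.coe_image, Finset.coe_insert]

/-- Re-rooting an admissible pattern of radius `ρ` at one of its points gives an admissible pattern of
radius `2ρ`. [folklore] -/
theorem meanCampbell_isRootedPattern_reroot {δ ρ : ℝ} {T : Finset (EuclideanSpace ℝ (Fin 3))}
    (hT : IsRootedPattern δ ρ T) {v : EuclideanSpace ℝ (Fin 3)} (hv : v ∈ T) :
    IsRootedPattern δ (2 * ρ) (reroot T v) := by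
  have hvρ : ‖v‖ ≤ ρ := (hT.1 v hv).2
  have hpair : ∀ z ∈ insert (0 : EuclideanSpace ℝ (Fin 3)) T,
      ∀ z' ∈ insert (0 : EuclideanSpace ℝ (Fin 3)) T, z ≠ z' → δ ≤ ‖z - z'‖ := by
    intro z hz z' hz' hzz'
    rcases Finset.mem_insert.1 hz with rfl | hzS
    · rcases Finset.mem_insert.1 hz' with rfl | hz'S
      · exact absurd rfl hzz'
      · rw [zero_sub, norm_neg]; exact (hT.1 z' hz'S).1
    · rcases Finset.mem_insert.1 hz' with rfl | hz'S
      · rw [sub_zero]; exact (hT.1 z hzS).1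
      · exact hT.2 z hzS z' hz'S hzz'
  have hnorm : ∀ z ∈ insert (0 : EuclideanSpace ℝ (Fin 3)) T, ‖z‖ ≤ ρ := by
    intro z hz
    rcases Finset.mem_insert.1 hz with rfl | hzS
    · rw [norm_zero]; exact (norm_nonneg v).trans hvρ
    · exact (hT.1 z hzS).2
  refine ⟨fun y hy => ?_, fun y hy y' hy' hyy' => ?_⟩
  · simp only [reroot, Finset.mem_erase, Finset.mem_image] at hy
    obtain ⟨hy0, z, hz, rfl⟩ := hy
    refine ⟨hpair z hz v (Finset.mem_insert_of_mem hv) fun h => hy0 (by rw [h, sub_self]), ?_⟩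
    calc ‖z - v‖ ≤ ‖z‖ + ‖v‖ := norm_sub_le _ _
      _ ≤ ρ + ρ := add_le_add (hnorm z hz) hvρ
      _ = 2 * ρ := by ring
  · simp only [reroot, Finset.mem_erase, Finset.mem_image] at hy hy'
    obtain ⟨-, z, hz, rfl⟩ := hy
    obtain ⟨-, z', hz', rfl⟩ := hy'
    have hzz' : z ≠ z' := fun h => hyy' (by rw [h])
    have : z - v - (z' - v) = z - z' := by abel
    rw [this]
    exact hpair z hz z' hz' hzz'

/-- Packing: an admissible pattern has at most `(2 max(R,0)/δ + 1)³` points of norm `≤ R`. [folklore] -/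
theorem meanCampbell_card_ballPattern_le {δ ρ : ℝ} (hδ : 0 < δ) (R : ℝ)
    {T : Finset (EuclideanSpace ℝ (Fin 3))} (hT : IsRootedPattern δ ρ T) :
    ((ballPattern R T).card : ℝ) ≤ (2 * max R 0 / δ + 1) ^ 3 :=
  meanDuality_card_le hδ (levelLift_isRootedPattern_ballPattern R hT)

end PatternLemmas

section ConfigLemmas

variable {δ : ℝ}

/-- Re-rooting a rooted configuration at its root does nothing. [folklore] -/
theorem meanCampbell_reroot_zero (S : LocalConfig.RootedHardCoreConfig (EuclideanSpace ℝ (Fin 3)) δ)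
    (h : (0 : EuclideanSpace ℝ (Fin 3)) ∈ ((↑S.1 : Set (EuclideanSpace ℝ (Fin 3))))) : S.reroot 0 h = S :=
  Subtype.ext (LocalConfig.translate_zero _)

/-- **Re-rooting commutes with the finite embedding**: `(ι T) − v = ι (reroot T v)` for an admissible
`T` and `v ∈ T`. [folklore] -/
theorem meanCampbell_iota_reroot
    {ι : Finset (EuclideanSpace ℝ (Fin 3)) → LocalConfig.RootedHardCoreConfig (EuclideanSpace ℝ (Fin 3)) δ}
    (hι : ∀ (ρ : ℝ) (T : Finset (EuclideanSpace ℝ (Fin 3))), IsRootedPattern δ ρ T →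
      ((↑(ι T).1 : Set (EuclideanSpace ℝ (Fin 3)))) =
        insert (0 : EuclideanSpace ℝ (Fin 3)) (↑T : Set (EuclideanSpace ℝ (Fin 3))))
    {ρ : ℝ} {T : Finset (EuclideanSpace ℝ (Fin 3))} (hT : IsRootedPattern δ ρ T)
    {v : EuclideanSpace ℝ (Fin 3)} (hv : v ∈ T)
    (hv' : v ∈ ((↑(ι T).1 : Set (EuclideanSpace ℝ (Fin 3))))) :
    (ι T).reroot v hv' = ι (reroot T v) := by
  refine Subtype.ext (SetLike.coe_injective ?_)
  rw [LocalConfig.RootedHardCoreConfig.coe_reroot, hι ρ T hT,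
    hι (2 * ρ) (reroot T v) (meanCampbell_isRootedPattern_reroot hT hv), meanCampbell_coe_insert_reroot T hv]

/-- **Cutting to the `r`-ball is `r⁻¹`-small in the local rubber metric**: `ι T` and `ι (B_r T)` agree
on the closed `r`-ball, so `dist (ι T) (ι (B_r T)) ≤ r⁻¹`. [folklore] -/
theorem meanCampbell_dist_iota_ballPattern
    {ι : Finset (EuclideanSpace ℝ (Fin 3)) → LocalConfig.RootedHardCoreConfig (EuclideanSpace ℝ (Fin 3)) δ}
    (hι : ∀ (ρ : ℝ) (T : Finset (EuclideanSpace ℝ (Fin 3))), IsRootedPattern δ ρ T →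
      ((↑(ι T).1 : Set (EuclideanSpace ℝ (Fin 3)))) =
        insert (0 : EuclideanSpace ℝ (Fin 3)) (↑T : Set (EuclideanSpace ℝ (Fin 3))))
    {ρ : ℝ} {T : Finset (EuclideanSpace ℝ (Fin 3))} (hT : IsRootedPattern δ ρ T) {r : ℝ} (hr : 0 < r) :
    dist (ι T) (ι (ballPattern r T)) ≤ r⁻¹ := by
  rw [Subtype.dist_eq]
  refine LocalConfig.dist_le_of_locallyMatches (inv_pos.2 hr) ?_
  rw [inv_inv, hι ρ T hT, hι r (ballPattern r T) (levelLift_isRootedPattern_ballPattern r hT)]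
  refine ⟨fun p hp _ => ⟨p, ?_, by rw [dist_self]; exact (inv_pos.2 hr).le⟩,
    fun q hq hqr => ⟨q, ?_, by rw [dist_self]; exact (inv_pos.2 hr).le⟩⟩
  · rcases Set.mem_insert_iff.1 hp with rfl | hp
    · exact Set.mem_insert _ _
    · refine Set.mem_insert_of_mem _ ?_
      rw [Finset.mem_coe] at hp ⊢
      exact (Finset.mem_filter.1 hp).1
  · rcases Set.mem_insert_iff.1 hq with rfl | hq
    · exact Set.mem_insert _ _
    · refine Set.mem_insert_of_mem _ ?_
      rw [Finset.mem_coe] at hq ⊢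
      exact Finset.mem_filter.2 ⟨hq, hqr⟩

/-- A local functional evaluated on the embedded pattern `ι T` is the finite sum over `insert 0 T`.
[folklore] -/
theorem meanCampbell_integral_iota
    {ι : Finset (EuclideanSpace ℝ (Fin 3)) → LocalConfig.RootedHardCoreConfig (EuclideanSpace ℝ (Fin 3)) δ}
    (hι : ∀ (ρ : ℝ) (T : Finset (EuclideanSpace ℝ (Fin 3))), IsRootedPattern δ ρ T →
      ((↑(ι T).1 : Set (EuclideanSpace ℝ (Fin 3)))) =
        insert (0 : EuclideanSpace ℝ (Fin 3)) (↑T : Set (EuclideanSpace ℝ (Fin 3))))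
    (hδ : 0 < δ) {ρ : ℝ} {T : Finset (EuclideanSpace ℝ (Fin 3))} (hT : IsRootedPattern δ ρ T)
    (f : EuclideanSpace ℝ (Fin 3) → ℝ) :
    ∫ y, f y ∂(LocalConfig.toMeasure (ι T).1) = f 0 + ∑ v ∈ T, f v := by
  rw [LocalConfig.toMeasure_def, hι ρ T hT, ← Finset.coe_insert,
    LocalConfig.integral_count_restrict_finset, Finset.sum_insert (meanCampbell_zero_notMem hδ hT)]

end ConfigLemmas

section Estimate

variable {δ : ℝ}

/-- **The two Campbell integrands on an embedded admissible pattern.** For `T` admissible and `G` vanishing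
for `‖y‖ > R`: `∫ G(ι T, y) d(count|ι T) − ∫ G((ι T) − y, −y) d(count|ι T)
= Σ_{v ∈ T, ‖v‖ ≤ R} [G(ι T, v) − G(ι(reroot T v), −v)]` (the root terms agree, `(ι T) − v = ι(reroot T v)`,
and far terms vanish). [folklore] -/
theorem meanCampbell_diff_eq (hδ : 0 < δ)
    {ι : Finset (EuclideanSpace ℝ (Fin 3)) → LocalConfig.RootedHardCoreConfig (EuclideanSpace ℝ (Fin 3)) δ}
    (hι : ∀ (ρ : ℝ) (T : Finset (EuclideanSpace ℝ (Fin 3))), IsRootedPattern δ ρ T →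
      ((↑(ι T).1 : Set (EuclideanSpace ℝ (Fin 3)))) =
        insert (0 : EuclideanSpace ℝ (Fin 3)) (↑T : Set (EuclideanSpace ℝ (Fin 3))))
    (G : LocalConfig.RootedHardCoreConfig (EuclideanSpace ℝ (Fin 3)) δ × (EuclideanSpace ℝ (Fin 3)) → ℝ)
    {R : ℝ} (hR : ∀ S y, R < ‖y‖ → G (S, y) = 0)
    {ρ : ℝ} {T : Finset (EuclideanSpace ℝ (Fin 3))} (hT : IsRootedPattern δ ρ T) :
    (∫ y, G (ι T, y) ∂(LocalConfig.toMeasure (ι T).1)) -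
        (∫ y, (if h : y ∈ ((↑(ι T).1 : Set (EuclideanSpace ℝ (Fin 3)))) then G ((ι T).reroot y h, -y) else 0)
          ∂(LocalConfig.toMeasure (ι T).1)) =
      ∑ v ∈ ballPattern R T, (G (ι T, v) - G (ι (reroot T v), -v)) := by
  rw [meanCampbell_integral_iota hι hδ hT, meanCampbell_integral_iota hι hδ hT]
  have h0 : (0 : EuclideanSpace ℝ (Fin 3)) ∈ ((↑(ι T).1 : Set (EuclideanSpace ℝ (Fin 3)))) := (ι T).2.1
  have hmem : ∀ v ∈ T, v ∈ ((↑(ι T).1 : Set (EuclideanSpace ℝ (Fin 3)))) := fun v hv => by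
    rw [hι ρ T hT]
    exact Set.mem_insert_of_mem _ (Finset.mem_coe.2 hv)
  rw [dif_pos h0, meanCampbell_reroot_zero, neg_zero]
  have hsum : ∑ v ∈ T, (if h : v ∈ ((↑(ι T).1 : Set (EuclideanSpace ℝ (Fin 3)))) then
      G ((ι T).reroot v h, -v) else 0) = ∑ v ∈ T, G (ι (reroot T v), -v) := by
    refine Finset.sum_congr rfl fun v hv => ?_
    rw [dif_pos (hmem v hv), meanCampbell_iota_reroot hι hT hv]
  rw [hsum, add_sub_add_left_eq_sub, ← Finset.sum_sub_distrib]
  unfold ballPattern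
  rw [Finset.sum_filter]
  refine Finset.sum_congr rfl fun v _ => ?_
  split_ifs with h
  · rfl
  · rw [hR _ _ (not_le.1 h), hR _ _ (by rw [norm_neg]; exact not_le.1 h), sub_zero]

/-- **The level-`(r, ρ)` transport of the rule `g v p q = 1[‖v‖ ≤ R] G(ι p, v)`** for `R ≤ ρ − r`: all
displacements of norm `≤ R` lie in the lens range, and the others do not contribute. [folklore] -/
theorem meanCampbell_transport_eq
    (ι : Finset (EuclideanSpace ℝ (Fin 3)) → LocalConfig.RootedHardCoreConfig (EuclideanSpace ℝ (Fin 3)) δ)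
    (G : LocalConfig.RootedHardCoreConfig (EuclideanSpace ℝ (Fin 3)) δ × (EuclideanSpace ℝ (Fin 3)) → ℝ)
    {R r ρ : ℝ} (hRρ : R ≤ ρ - r) (T : Finset (EuclideanSpace ℝ (Fin 3))) :
    ∑ v ∈ lens r ρ T, ((if ‖v‖ ≤ R then G (ι (ballPattern r T), v) else 0) -
        (if ‖-v‖ ≤ R then G (ι (ballPattern r (reroot T v)), -v) else 0)) =
      ∑ v ∈ ballPattern R T, (G (ι (ballPattern r T), v) - G (ι (ballPattern r (reroot T v)), -v)) := by
  have hfilter : ballPattern R T = (lens r ρ T).filter fun v => ‖v‖ ≤ R := by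
    ext v
    simp only [ballPattern, lens, Finset.mem_filter]
    exact ⟨fun h => ⟨⟨h.1, h.2.trans hRρ⟩, h.2⟩, fun h => ⟨h.1.1, h.2⟩⟩
  rw [hfilter, Finset.sum_filter]
  refine Finset.sum_congr rfl fun v _ => ?_
  rw [norm_neg]
  split_ifs <;> simp

/-- **The level estimate (registered sub-goal of `stub_meanCampbell`).** For `δ > 0`, the finite embedding
`ι`, a continuous local test function `G(S, y)` vanishing for `‖y‖ > R`, and `η > 0`, there is a cut
radius `r > 0` such that at every level `ρ ≥ r + R` and on every `(δ, ρ)`-admissible pattern `T` the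
difference of the two Campbell integrands at `ι T` is, up to `η`, the level-`(r, ρ)` transport of the bounded
rule `g v p q = 1[‖v‖ ≤ R] G(ι p, v)`: cutting to the `r`-ball moves a configuration by `≤ r⁻¹` in the local
rubber metric, `G` is uniformly continuous on the compact `𝒳 × B̄_R`, and there are at most
`(2 max(R,0)/δ + 1)³` terms. [folklore] -/
theorem meanCampbell_levelEstimate :
    ∀ δ : ℝ, 0 < δ → ∀ ι : Finset (EuclideanSpace ℝ (Fin 3)) → Literature.Probability.Process.LocalConfig.RootedHardCoreConfig (EuclideanSpace ℝ (Fin 3)) δ, (∀ (ρ : ℝ) (T : Finset (EuclideanSpace ℝ (Fin 3))), Literature.Probability.PointProcesses.IsRootedPattern δ ρ T → ((↑(ι T).1 : Set (EuclideanSpace ℝ (Fin 3)))) = insert (0 : (EuclideanSpace ℝ (Fin 3))) (↑T : Set (EuclideanSpace ℝ (Fin 3)))) → ∀ G : Literature.Probability.Process.LocalConfig.RootedHardCoreConfig (EuclideanSpace ℝ (Fin 3)) δ × (EuclideanSpace ℝ (Fin 3)) → ℝ, Continuous G → ∀ R : ℝ, (∀ S y, R < ‖y‖ → G (S, y) = 0)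 → ∀ η : ℝ, 0 < η → ∃ r : ℝ, 0 < r ∧ ∀ ρ : ℝ, r + R ≤ ρ → ∀ T : Finset (EuclideanSpace ℝ (Fin 3)), Literature.Probability.PointProcesses.IsRootedPattern δ ρ T → |(∫ y, G (ι T, y) ∂(Literature.Probability.Process.LocalConfig.toMeasure (ι T).1)) - (∫ y, (if h : y ∈ ((↑(ι T).1 : Set (EuclideanSpace ℝ (Fin 3)))) then G ((ι T).reroot y h, -y) else 0) ∂(Literature.Probability.Process.LocalConfig.toMeasure (ι T).1)) - ∑ v ∈ Literature.Probability.PointProcesses.lens r ρ T, ((if ‖v‖ ≤ R then G (ι (Literature.Probability.PointProcesses.ballPattern r T), v) else 0) - (if ‖-v‖ ≤ R then G (ι (Literature.Probability.PointProcesses.ballPattern r (Literature.Probability.PointProcesses.reroot T v)), -v) else 0))| ≤ η := by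
  intro δ hδ ι hι G hG R hR η hη
  haveI : Fact (0 < δ) := ⟨hδ⟩
  -- the number of terms
  set N : ℝ := (2 * max R 0 / δ + 1) ^ 3 with hN
  have hN0 : 0 < N := by positivity
  -- uniform continuity of `G` on the compact `𝒳 × B̄_R`
  have hK : IsCompact ((Set.univ : Set (LocalConfig.RootedHardCoreConfig (EuclideanSpace ℝ (Fin 3)) δ)) ×ˢ
      Metric.closedBall (0 : EuclideanSpace ℝ (Fin 3)) R) :=
    isCompact_univ.prod (isCompact_closedBall _ _)
  obtain ⟨θ, hθ, hθG⟩ := Metric.uniformContinuousOn_iff.1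
    (hK.uniformContinuousOn_of_continuous hG.continuousOn) (η / (2 * N)) (by positivity)
  refine ⟨θ⁻¹ + 1, by positivity, fun ρ hρ T hT => ?_⟩
  set r : ℝ := θ⁻¹ + 1 with hr_def
  have hr : 0 < r := by positivity
  have hrθ : r⁻¹ < θ := by
    rw [inv_lt_comm₀ hr hθ]
    linarith
  rw [meanCampbell_diff_eq hδ hι G hR hT, meanCampbell_transport_eq ι G (by linarith) T,
    ← Finset.sum_sub_distrib]
  -- termwise estimate by uniform continuity
  have hterm : ∀ v ∈ ballPattern R T, |G (ι T, v) - G (ι (reroot T v), -v) -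
      (G (ι (ballPattern r T), v) - G (ι (ballPattern r (reroot T v)), -v))| ≤
        η / (2 * N) + η / (2 * N) := by
    intro v hv
    have hvT : v ∈ T := (Finset.mem_filter.1 hv).1
    have hvR : ‖v‖ ≤ R := (Finset.mem_filter.1 hv).2
    have hvR' : -v ∈ Metric.closedBall (0 : EuclideanSpace ℝ (Fin 3)) R := by
      rw [mem_closedBall_zero_iff, norm_neg]; exact hvR
    have hTv := meanCampbell_isRootedPattern_reroot hT hvT
    have h1 : dist (G (ι T, v)) (G (ι (ballPattern r T), v)) < η / (2 * N) := by
      refine hθG (ι T, v) ⟨Set.mem_univ _, mem_closedBall_zero_iff.2 hvR⟩ (ι (ballPattern r T), v)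
        ⟨Set.mem_univ _, mem_closedBall_zero_iff.2 hvR⟩ ?_
      rw [Prod.dist_eq, dist_self]
      exact max_lt ((meanCampbell_dist_iota_ballPattern hι hT hr).trans_lt hrθ) hθ
    have h2 : dist (G (ι (reroot T v), -v)) (G (ι (ballPattern r (reroot T v)), -v)) < η / (2 * N) := by
      refine hθG (ι (reroot T v), -v) ⟨Set.mem_univ _, hvR'⟩ (ι (ballPattern r (reroot T v)), -v)
        ⟨Set.mem_univ _, hvR'⟩ ?_
      rw [Prod.dist_eq, dist_self]
      exact max_lt ((meanCampbell_dist_iota_ballPattern hι hTv hr).trans_lt hrθ) hθ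
    rw [Real.dist_eq] at h1 h2
    have : G (ι T, v) - G (ι (reroot T v), -v) -
        (G (ι (ballPattern r T), v) - G (ι (ballPattern r (reroot T v)), -v)) =
        (G (ι T, v) - G (ι (ballPattern r T), v)) -
          (G (ι (reroot T v), -v) - G (ι (ballPattern r (reroot T v)), -v)) := by ring
    rw [this]
    exact (abs_sub _ _).trans (add_le_add h1.le h2.le)
  refine (Finset.abs_sum_le_sum_abs _ _).trans ((Finset.sum_le_sum hterm).trans ?_)
  rw [Finset.sum_const, nsmul_eq_mul]
  calc ((ballPattern R T).card : ℝ) * (η / (2 * N) + η / (2 * N))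
      ≤ N * (η / (2 * N) + η / (2 * N)) := by
        gcongr
        exact meanCampbell_card_ballPattern_le hδ R hT
    _ = η := by
        field_simp
        ring

end Estimate

end Summit.AtomisticToContinuum.Crystallization.Theorems.PatternPricedCertificates

end
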